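import Mathlib
import Summits.MatrixMultiplication.MatrixMultiplication.Theorems.HiddenToeplitzCornersHiddenCornerLemmaRTailSlot

/-!
# X-descent: a frame with a short exact syzygy carries no common target

Support file for crux item `stmt-MatrixMultiplication-10752`
(`Summit.MatrixMultiplication.MatrixMultiplication.Theses.HiddenToeplitzCorners.HiddenCornerLemmaR`),
line `atkinson-lloyd-core-split`, stub `hclR_x_descent` (theorem (G1): the X-descent theorem for
the `G`-constant class, general frames, all `p`).

Model `ℂ^N = ℂ[X]/(X^N)`: a column `e` is a polynomial of degree `< N`, and the *tail* of `e`
against a constant vector `v` is `κ(v, e) = ∑_i v_i · (e /ₘ X^i)`; the class member with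
coefficient tails `η_{b k}` sends `e_c` to `∑_k g_k κ(η_{b k}, e_c) (mod X^N)`.

* `hclR_x_descent` — X-DESCENT THEOREM.  Data: generators `g_k`, a frame `e_c` (`deg < N`), a
  candidate common target `φ` (`deg < N`), an exact frame syzygy `P ≠ 0`, `deg P_c ≤ μ`,
  `∑_c P_c e_c = 0`, the hypothesis "no short generator syzygy of length `2μ`" (every `β` with
  coefficients vanishing from degree `2μ` on and `X^N ∣ ∑_k g_k β_k` is `0`), and the corner
  hypothesis `∑_k g_k κ(η_{b k}, e_c) ≡ [b = c] φ (mod X^N)` for all slots `b, c`.  Then `φ = 0`.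
  Proof: (0) divide `P` by a generator of the ideal `(P_c)_c` to make the family coprime with a
  Bezout relation `∑_c a_c P_c = 1`; (1) TAILS ARE SHORT (`hclR_tail_lowdeg_corr`):
  `S_{b k} := ∑_c P_c κ(η_{b k}, e_c)` has no coefficient from degree `max_c deg P_c` on;
  (2) summing the corner hypothesis against `P` and cross-multiplying two slots gives
  `X^N ∣ ∑_k g_k (P_c S_{b k} - P_b S_{c k})` with short brackets, so all brackets vanish;
  (3) by Bezout `S_{b k} = P_b θ_k`, and comparing degrees at a slot of maximal `deg P_c` forces
  `θ_k = 0`, whence `X^N ∣ P_b φ` for every `b` and, by Bezout again, `X^N ∣ φ`, `φ = 0`.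
  Pure polynomial algebra; nothing beyond Mathlib and the tail lemma.
-/

-- D-0017: the single-problem layout `Summits/<S>/<S>/…` duplicates a namespace segment by design.
set_option linter.dupNamespace false

namespace Summit.MatrixMultiplication.MatrixMultiplication.Theorems

open Polynomial BigOperators Finset

/-- A polynomial whose coefficients vanish from degree `M` on is zero or has `natDegree < M`. -/
private theorem hclR_xd_natDegree_lt (p : ℂ[X]) (M : ℕ) (hp : ∀ K, M ≤ K → p.coeff K = 0)
    (hz : p ≠ 0) : p.natDegree < M := by
  by_contra h
  have := hp _ (not_lt.mp h)
  rw [coeff_natDegree, leadingCoeff_eq_zero] at this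
  exact hz this

/-- If `deg Q ≤ μ` and the coefficients of `S` vanish from degree `μ₀` on, then the coefficients
of `Q * S` vanish from degree `μ + μ₀` on. -/
private theorem hclR_xd_coeff_mul_eq_zero {Q S : ℂ[X]} {μ μ₀ n : ℕ} (hQ : Q.natDegree ≤ μ)
    (hS : ∀ K, μ₀ ≤ K → S.coeff K = 0) (hn : μ + μ₀ ≤ n) : (Q * S).coeff n = 0 := by
  rw [coeff_mul]
  refine Finset.sum_eq_zero fun ij hij => ?_
  have hij' : ij.1 + ij.2 = n := by simpa using hij
  rcases lt_or_ge μ ij.1 with h | h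
  · rw [coeff_eq_zero_of_natDegree_lt (hQ.trans_lt h), zero_mul]
  · rw [hS ij.2 (by omega), mul_zero]

/-- **Coprime reduction of a family.**  A nonzero family `P` of polynomials over `ℂ` is `D • Q`
for a nonzero `D` (a generator of the ideal spanned by the family) and a family `Q` with a
Bezout relation `∑_c a_c Q_c = 1`. -/
private theorem hclR_xd_coprime_reduction {r : ℕ} (P : Fin r → ℂ[X]) (hP0 : P ≠ 0) :
    ∃ (D : ℂ[X]) (Q a : Fin r → ℂ[X]), D ≠ 0 ∧ (∀ c, P c = D * Q c) ∧ ∑ c, a c * Q c = 1 := by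
  classical
  obtain ⟨c₁, hc₁⟩ : ∃ c, P c ≠ 0 := by
    by_contra hall
    push Not at hall
    exact hP0 (funext hall)
  let I : Ideal ℂ[X] := Ideal.span (Set.range P)
  have hdvd : ∀ c, Submodule.IsPrincipal.generator I ∣ P c := fun c =>
    (Submodule.IsPrincipal.mem_iff_generator_dvd I).mp (Ideal.subset_span (Set.mem_range_self c))
  choose Q hQ using hdvd
  obtain ⟨a, ha⟩ := Ideal.mem_span_range_iff_exists_fun.mp (Submodule.IsPrincipal.generator_mem I)
  have hD0 : Submodule.IsPrincipal.generator I ≠ 0 := by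
    intro h
    apply hc₁
    rw [hQ c₁, h, zero_mul]
  refine ⟨Submodule.IsPrincipal.generator I, Q, a, hD0, hQ, mul_left_cancel₀ hD0 ?_⟩
  rw [mul_one, Finset.mul_sum]
  conv_rhs => rw [← ha]
  exact Finset.sum_congr rfl fun c _ => by rw [hQ c]; ring

/-- **X-descent theorem.**  Let `g_k` be generators, `e_c` a frame and `φ` a candidate common
target (all of degree `< N`), and `P ≠ 0` an exact frame syzygy (`deg P_c ≤ μ`,
`∑_c P_c e_c = 0`).  If the generators have no short syzygy of length `2μ` (every `β` with
coefficients vanishing from degree `2μ` on and `X^N ∣ ∑_k g_k β_k` is zero) and the class member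
with coefficient tails `η_{b k}` kills `e_c` for `c ≠ b` and sends `e_b` to `φ` modulo `X^N`,
i.e. `X^N ∣ ∑_k g_k κ(η_{b k}, e_c) - [b = c] φ` with `κ(v, e) = ∑_i v_i (e /ₘ X^i)`, then
`φ = 0`. -/
theorem hclR_x_descent :
    ∀ (N p r μ : ℕ) (g : Fin p → Polynomial ℂ) (η : Fin r → Fin p → Fin N → ℂ)
      (e P : Fin r → Polynomial ℂ) (φ : Polynomial ℂ),
      (∀ (c : Fin r) (n : ℕ), N ≤ n → (e c).coeff n = 0) → (∀ n : ℕ, N ≤ n → φ.coeff n = 0) →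
      (∀ c : Fin r, (P c).natDegree ≤ μ) → P ≠ 0 → (∑ c : Fin r, P c * e c) = 0 →
      (∀ β : Fin p → Polynomial ℂ, (∀ (k : Fin p) (n : ℕ), 2 * μ ≤ n → (β k).coeff n = 0) →
        (Polynomial.X : Polynomial ℂ) ^ N ∣ (∑ k : Fin p, g k * β k) → β = 0) →
      (∀ b c : Fin r, (Polynomial.X : Polynomial ℂ) ^ N ∣
        (∑ k : Fin p, g k * ∑ i : Fin N, Polynomial.C (η b k i) *
          (e c /ₘ (Polynomial.X : Polynomial ℂ) ^ (i : ℕ))) - (if b = c then φ else 0)) →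
      φ = 0 := by
  intro N p r μ g η e P φ _he hφ hPdeg hP0 hsyz hshort hcorner
  classical
  -- tails of the frame against the coefficient vectors `η b k`
  obtain ⟨κ, hκ⟩ : ∃ κ : Fin r → Fin p → Fin r → ℂ[X],
      ∀ b k c, κ b k c = ∑ i : Fin N, C (η b k i) * (e c /ₘ X ^ (i : ℕ)) := ⟨_, fun _ _ _ => rfl⟩
  simp only [← hκ] at hcorner
  -- (0) coprime reduction: `P = D • Q`, `∑_c a_c Q_c = 1`
  obtain ⟨D, Q, a, hD0, hPQ, hbez⟩ := hclR_xd_coprime_reduction P hP0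
  have hQdeg : ∀ c, (Q c).natDegree ≤ μ := by
    intro c
    by_cases hQc : Q c = 0
    · rw [hQc, natDegree_zero]
      exact Nat.zero_le _
    · have hPc : P c ≠ 0 := by
        rw [hPQ c]
        exact mul_ne_zero hD0 hQc
      exact (natDegree_le_of_dvd (Dvd.intro_left D (hPQ c).symm) hPc).trans (hPdeg c)
  have hQsyz : ∑ c, Q c * e c = 0 := by
    have h1 : D * ∑ c, Q c * e c = ∑ c, P c * e c := by
      rw [Finset.mul_sum]
      exact Finset.sum_congr rfl fun c _ => by rw [hPQ c, mul_assoc]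
    rw [hsyz] at h1
    exact (mul_eq_zero.mp h1).resolve_left hD0
  obtain ⟨b₁, hb₁⟩ : ∃ b, Q b ≠ 0 := by
    by_contra hall
    push Not at hall
    have h1 : (1 : ℂ[X]) = 0 := by
      rw [← hbez]
      exact Finset.sum_eq_zero fun c _ => by rw [hall c, mul_zero]
    exact one_ne_zero h1
  -- a slot `c₀` of maximal degree `μ₀ := deg Q c₀`
  obtain ⟨c₀, -, hc₀⟩ :=
    Finset.exists_max_image Finset.univ (fun c => (Q c).natDegree) ⟨b₁, Finset.mem_univ _⟩
  have hQdeg₀ : ∀ c, (Q c).natDegree ≤ (Q c₀).natDegree := fun c => hc₀ c (Finset.mem_univ c)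
  -- (1) tails are short: `S b k := ∑_c Q_c κ(η b k, e_c)` has no coefficient from `μ₀` on
  obtain ⟨S, hS⟩ : ∃ S : Fin r → Fin p → ℂ[X], ∀ b k, S b k = ∑ c, Q c * κ b k c :=
    ⟨_, fun _ _ => rfl⟩
  have hSμ : ∀ b k K, μ ≤ K → (S b k).coeff K = 0 := by
    intro b k K hK
    rw [hS]
    simp only [hκ]
    exact hclR_tail_lowdeg_corr μ (η b k) Q e hQdeg hQsyz K hK
  have hSμ₀ : ∀ b k K, (Q c₀).natDegree ≤ K → (S b k).coeff K = 0 := by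
    intro b k K hK
    rw [hS]
    simp only [hκ]
    exact hclR_tail_lowdeg_corr (Q c₀).natDegree (η b k) Q e hQdeg₀ hQsyz K hK
  -- (2) sum the corner hypotheses of row `b` against `Q`
  have hrow : ∀ b, (X : ℂ[X]) ^ N ∣ (∑ k, g k * S b k) - Q b * φ := by
    intro b
    have h1 : (∑ k, g k * S b k) - Q b * φ =
        ∑ c, Q c * ((∑ k, g k * κ b k c) - (if b = c then φ else 0)) := by
      simp only [mul_sub, Finset.sum_sub_distrib, hS, Finset.mul_sum, mul_ite, mul_zero,
        Finset.sum_ite_eq, Finset.mem_univ, if_true]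
      congr 1
      rw [Finset.sum_comm]
      exact Finset.sum_congr rfl fun c _ => Finset.sum_congr rfl fun k _ => by ring
    rw [h1]
    exact Finset.dvd_sum fun c _ => dvd_mul_of_dvd_right (hcorner b c) _
  -- cross-multiplying two slots: the brackets are short generator syzygies, hence vanish
  have hcross : ∀ b c k, Q c * S b k = Q b * S c k := by
    intro b c
    have hβ := hshort (fun k => Q c * S b k - Q b * S c k) (fun k n hn => by
      rw [coeff_sub, hclR_xd_coeff_mul_eq_zero (hQdeg c) (hSμ b k) (by omega),
        hclR_xd_coeff_mul_eq_zero (hQdeg b) (hSμ c k) (by omega), sub_zero]) (by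
      have h1 : ∑ k, g k * (Q c * S b k - Q b * S c k) =
          Q c * ((∑ k, g k * S b k) - Q b * φ) - Q b * ((∑ k, g k * S c k) - Q c * φ) := by
        rw [mul_sub, mul_sub, Finset.mul_sum, Finset.mul_sum]
        have h2 : ∑ k, g k * (Q c * S b k - Q b * S c k) =
            ∑ k, Q c * (g k * S b k) - ∑ k, Q b * (g k * S c k) := by
          rw [← Finset.sum_sub_distrib]
          exact Finset.sum_congr rfl fun k _ => by ring
        rw [h2]
        ring
      rw [h1]
      exact dvd_sub (dvd_mul_of_dvd_right (hrow b) _) (dvd_mul_of_dvd_right (hrow c) _))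
    intro k
    exact sub_eq_zero.mp (congr_fun hβ k)
  -- (3) parallel vectors: `S b k = Q b * θ k` by Bezout, and `θ k = 0` by degrees at `c₀`
  obtain ⟨θ, hθ⟩ : ∃ θ : Fin p → ℂ[X], ∀ k, θ k = ∑ c, a c * S c k := ⟨_, fun _ => rfl⟩
  have hSθ : ∀ b k, S b k = Q b * θ k := by
    intro b k
    calc S b k = (∑ c, a c * Q c) * S b k := by rw [hbez, one_mul]
      _ = ∑ c, a c * (Q b * S c k) := by
          rw [Finset.sum_mul]
          exact Finset.sum_congr rfl fun c _ => by rw [mul_assoc, hcross b c k]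
      _ = Q b * θ k := by
          rw [hθ, Finset.mul_sum]
          exact Finset.sum_congr rfl fun c _ => by ring
  have hθ0 : ∀ k, θ k = 0 := by
    intro k
    by_contra hθk
    have h1 : (S b₁ k).natDegree < (Q c₀).natDegree :=
      hclR_xd_natDegree_lt (S b₁ k) _ (hSμ₀ b₁ k) (by rw [hSθ]; exact mul_ne_zero hb₁ hθk)
    have hQc₀ : Q c₀ ≠ 0 := by
      intro h
      rw [h, natDegree_zero] at h1
      exact Nat.not_lt_zero _ h1
    have h2 : (S c₀ k).natDegree < (Q c₀).natDegree :=
      hclR_xd_natDegree_lt (S c₀ k) _ (hSμ₀ c₀ k) (by rw [hSθ]; exact mul_ne_zero hQc₀ hθk)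
    rw [hSθ, natDegree_mul hQc₀ hθk] at h2
    omega
  have hS0 : ∀ b k, S b k = 0 := fun b k => by rw [hSθ, hθ0 k, mul_zero]
  -- hence `X^N ∣ Q b * φ` for every slot, and `X^N ∣ φ` by Bezout
  have hdvdQ : ∀ b, (X : ℂ[X]) ^ N ∣ Q b * φ := by
    intro b
    have h1 := hrow b
    simp only [hS0, mul_zero, Finset.sum_const_zero, zero_sub, dvd_neg] at h1
    exact h1
  have hdvdφ : (X : ℂ[X]) ^ N ∣ φ := by
    have h1 : φ = ∑ b, a b * (Q b * φ) := by
      calc φ = (∑ b, a b * Q b) * φ := by rw [hbez, one_mul]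
        _ = ∑ b, a b * (Q b * φ) := by
            rw [Finset.sum_mul]
            exact Finset.sum_congr rfl fun b _ => by ring
    rw [h1]
    exact Finset.dvd_sum fun b _ => dvd_mul_of_dvd_right (hdvdQ b) _
  by_contra hφ0
  exact hφ0 (eq_zero_of_dvd_of_natDegree_lt hdvdφ
    (by rw [natDegree_X_pow]; exact hclR_xd_natDegree_lt φ N hφ hφ0))

end Summit.MatrixMultiplication.MatrixMultiplication.Theorems
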